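import Literature.NumberTheory.IwasawaTheory.Fukuda1994Thm1RankPackage
import Literature.NumberTheory.IwasawaTheory.Fukuda1994Thm1RankLayerCoinvariant
import Literature.NumberTheory.IwasawaTheory.FukudaGroupLayers
import HarnessLib

/-!
# Fukuda 1994, Theorem 1 (2) at finite level — the PACKAGE WITH COINVARIANT LAYERS: `Gal(H_p(K_{n+t})/K_n)`, its abelian normal subgroup
# `A = Gal(H_p/K_{n+t})`, a totally ramified inertia generator, the inertia family, the index/rank data of every layer, AND, for every pair
# `i ≤ j ≤ t`, the divisibility «`[G_j : N_j·G_j^p·⁅G_i, G_j⁆]` divides the order of the `Gal(K_{n+j}/K_{n+i})`-coinvariants of `Cl(K_{n+j})/p`»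
# (door L12 of the cell `bsd-potss`; proved)

Topic `NumberTheory/IwasawaTheory` (namespace = path). THEOREM-ONLY file (no definition, no named fact, no `sorry`), written by the prover
seat `bsd-potss-k9-c4` g26 (cell `bsd-potss`; `μ`-roads of the record lane of stmt-BirchSwinnertonDyer-19197; closes nothing).
It is the package `Fukuda1994Thm1RankPackage.exists_layer_package` of the prover seat k8t-c4 g20 VERBATIM (same construction of `T = K_{n+t}`,
`B = K_n`, `H_T`, `A`, `A₀`, `H_p = HqF`, `G = Gal(H_p/B)`, `A'`, the inertia groups, `g`, `𝓘`; same proof, line by line — exactly as conjA-anchor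
g21's `Fukuda1994Thm1RankPackageCentral`), exporting in addition, for every layer `j ≤ t` and every `i ≤ j`, the COINVARIANT divisibility
`[G_j : N_j·P_j·⁅A⟨g^{p^i}⟩, G_j⁆] ∣ [Cl(K_{n+j}) : Cl^p·⟨σc·c⁻¹ : σ ∈ Gal(K_{n+j}/K) fixing K_{n+i}⟩]`
(`Fukuda1994Thm1RankLayerCoinvariant.exists_layer_coinvariant`, this seat; the `G_i`, `G_j` produced there are identified with `A⟨g^{p^i}⟩` and the
`G_j` of `Fukuda1994Thm1RankLayer.exists_layer` by `FukudaGroup.layer_eq_sup_zpowers` — the subgroup of index `p^j` containing `A'` is unique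
because `G/A'` is cyclic).  A third copy of the 400-line construction is the price (the original cannot be post-processed: its `G` is hidden
behind `∃`).

Consumer: `ClassGroupPRankCoinvariantCriterion` (this seat): `rank_p` of the `Gal(K_{n+i+1}/K_{n+i})`-coinvariants of `Cl(K_{n+i+1})` `≤ p^i − 1`
⟹ `rank_p Cl(K_{n+k}) ≤` that rank for every `k` ⟹ bounded ranks ⟹ `μ = 0` (the coinvariant quotient is `X̄/T^{p^i}X̄` whatever `Y₀` is, so it
sees a free `𝔽_p⟦T⟧`-summand of `X/pX` from a SINGLE pair of consecutive layers, through genus theory one layer down).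

References: [Fukuda1994] Thm. 1, p. 264; [Washington1997] §13.3 Lemmas 13.14–13.18, Prop. 13.22; Lemma 13.3; [Lang1990] Ch. 3 §4, Ch. 13 §4;
[Cox2013] §8.A Thm. 8.10; [NeukirchANT1999] Ch. IV §6, Ch. VI §7 Thm. (7.1).
-/

noncomputable section

open scoped NumberField IsMulCommutative
open NumberField IsDedekindDomain Field IntermediateField

namespace Literature.NumberTheory.IwasawaTheory

open Literature.NumberTheory.EllipticCurves Literature.NumberTheory.GaloisRepresentations
  Literature.NumberTheory.NumberFields

variable {K : Type} [Field K] [NumberField K] {p : ℕ} [hp : Fact p.Prime]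

set_option maxHeartbeats 40000000 in
set_option synthInstance.maxHeartbeats 400000 in
/-- **The package with coinvariant layers.** For a `ℤ_p`-extension `κ` with Fukuda index `n₀ ≤ n` and `t ≥ 1` there are: a finite group `G`
(`= Gal(H_p(K_{n+t})/K_n)`), an abelian normal subgroup `A` of index `p^t` and order `p^{e_{n+t}}`, an element `g` with `⟨g⟩ ∩ A = 1`, `A⟨g⟩ = G`,
and a family `𝓘` of subgroups («inertia groups») with `I ∩ A = 1`, `I = 1 ∨ IA = G`, `⟨g⟩ ∈ 𝓘`, such that for every `j ≤ t` some subgroup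
`G_j ⊇ A` of index `p^j` has `[G_j : N_j] = p^{e_{n+j}}` and `[G_j : N_j·G_j^p] = p^{r_{n+j}}` (`N_j = G_j'·⟨I ∩ G_j⟩`; `e` = `ord_p h`,
`r` = `rank_p Cl` of the layers) — VERBATIM the package `exists_layer_package` of k8t-c4 g20 — AND, NEW: **for every `i ≤ j`,
`[G_j : N_j·G_j^p·⁅A⟨g^{p^i}⟩, G_j⁆]` divides `[Cl(K_{n+j}) : Cl^p·⟨σc·c⁻¹⟩]`**, `σ` ranging over the `K`-automorphisms of `K_{n+j}` fixing `K_{n+i}`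
pointwise (the order of the `Gal(K_{n+j}/K_{n+i})`-coinvariants of `Cl(K_{n+j})/p`; `A⟨g^{p^i}⟩ = G_i = Gal(H_p/K_{n+i})` by `FukudaGroup.layer_eq_sup_zpowers`;
`Fukuda1994Thm1RankLayerCoinvariant.exists_layer_coinvariant`).  Feeds `FukudaGroup.card_quotient_le_relIndex_commutator_sup_layer_pow_sup_commutator`
and `FukudaCoinvariant.card_quotient_le_of_card_quotient_coinvariant_lt` (the one-pair-of-layers coinvariant criterion for `μ = 0`).
[cite: Fukuda1994, Thm. 1, p. 264 (proof)] [cite: Washington1997, §13.3 Lemmas 13.15 and 13.18, Prop. 13.22]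
[cite: NeukirchANT1999, Ch. IV §6 and Ch. VI §7 Thm. (7.1)] [cite: Lang1990, Ch. 13 §4] -/
theorem exists_layer_package_coinvariant (κ : ZpExtension K p) {n₀ n : ℕ} (hκ : TotallyRamifiedFrom κ n₀) (hn : n₀ ≤ n) (t : ℕ) (ht : 1 ≤ t) :
    ∃ (G : Type) (_ : Group G) (_ : Finite G) (A : Subgroup G) (_ : A.Normal) (_ : IsMulCommutative A) (g : G)
      (𝓘 : Set (Subgroup G)),
      Subgroup.zpowers g ⊓ A = ⊥ ∧ A ⊔ Subgroup.zpowers g = ⊤ ∧ A.index = p ^ t ∧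
      (∀ I ∈ 𝓘, I ⊓ A = ⊥ ∧ (I = ⊥ ∨ I ⊔ A = ⊤)) ∧ Subgroup.zpowers g ∈ 𝓘 ∧
      Nat.card A = p ^ classNumberPExp κ (n + t) ∧
      ∀ j, j ≤ t → ∃ Gj : Subgroup G, A ≤ Gj ∧ Gj.index = p ^ j ∧
        (⁅Gj, Gj⁆ ⊔ ⨆ I ∈ 𝓘, I ⊓ Gj).relIndex Gj = p ^ classNumberPExp κ (n + j) ∧
        ((⁅Gj, Gj⁆ ⊔ ⨆ I ∈ 𝓘, I ⊓ Gj) ⊔ Subgroup.closure ((fun x : G => x ^ p) '' (Gj : Set G))).relIndex Gj =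
          p ^ classGroupPRank κ (n + j) ∧
        ∀ i, i ≤ j →
          (((⁅Gj, Gj⁆ ⊔ ⨆ I ∈ 𝓘, I ⊓ Gj) ⊔ Subgroup.closure ((fun x : G => x ^ p) '' (Gj : Set G))) ⊔
              ⁅A ⊔ Subgroup.zpowers (g ^ p ^ i), Gj⁆).relIndex Gj ∣
            ((powMonoidHom p : ClassGroup (𝓞 (κ.layer (n + j))) →* ClassGroup (𝓞 (κ.layer (n + j)))).range ⊔
              Subgroup.closure {x | ∃ (σ : (κ.layer (n + j)) ≃ₐ[K] (κ.layer (n + j)))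
                (_ : ∀ y : κ.layer (n + j), ((y : κ.layer (n + j)) : AlgebraicClosure K) ∈ κ.layer (n + i) → σ y = y)
                (c : ClassGroup (𝓞 (κ.layer (n + j)))), x = ClassGroup.mulEquiv (AmbiguousClass.intAut σ) c * c⁻¹}).index := by
  classical
  -- ### the top layer `T = K_{n+t}` as a type; `B = K_n` as an intermediate field of `T/K`
  haveI : FiniteDimensional K (κ.layer n) := κ.finiteDimensional_layer_holds n
  haveI : FiniteDimensional K (κ.layer (n + t)) := κ.finiteDimensional_layer_holds (n + t)
  haveI : IsGalois K (κ.layer n) := κ.isGalois_layer_holds n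
  haveI : IsGalois K (κ.layer (n + t)) := κ.isGalois_layer_holds (n + t)
  haveI : NumberField (κ.layer n) := NumberField.of_module_finite K _
  haveI : NumberField (κ.layer (n + t)) := NumberField.of_module_finite K _
  have hBF : κ.layer n ≤ κ.layer (n + t) := κ.layer_mono (Nat.le_add_right n t)
  obtain ⟨Bi, hBi⟩ : ∃ Bi : IntermediateField K (κ.layer (n + t)), Bi = IntermediateField.restrict hBF := ⟨_, rfl⟩
  let eB : (κ.layer n) ≃ₐ[K] Bi := (IntermediateField.restrict_algEquiv hBF).trans (IntermediateField.equivOfEq hBi.symm)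
  haveI : FiniteDimensional K Bi := LinearEquiv.finiteDimensional eB.toLinearEquiv
  haveI : IsGalois K Bi := IsGalois.of_algEquiv eB
  haveI : NumberField Bi := NumberField.of_module_finite K _
  haveI : IsGalois Bi (κ.layer (n + t)) := IsGalois.tower_top_of_isGalois K Bi (κ.layer (n + t))
  have hp0 : 0 < p := hp.out.pos
  have hdegKB : Module.finrank K Bi = p ^ n := by rw [← eB.toLinearEquiv.finrank_eq, κ.finrank_layer_holds n]
  have hdegBF : Module.finrank Bi (κ.layer (n + t)) = p ^ t := by
    have h := Module.finrank_mul_finrank K Bi (κ.layer (n + t))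
    rw [hdegKB, κ.finrank_layer_holds (n + t), pow_add] at h
    exact Nat.eq_of_mul_eq_mul_left (pow_pos hp0 n) h
  -- `Gal(T/B)` is cyclic
  haveI hcycF : IsCyclic ((κ.layer (n + t)) ≃ₐ[Bi] (κ.layer (n + t))) := by
    obtain ⟨ψ, -, hker, -⟩ := κ.exists_cyclicCharacter_layer (n + t)
    haveI : IsCyclic ((κ.layer (n + t)) ≃ₐ[K] (κ.layer (n + t))) := isCyclic_of_cyclicLayer ψ (κ.layer (n + t)) hker
    let j : ((κ.layer (n + t)) ≃ₐ[Bi] (κ.layer (n + t))) →* ((κ.layer (n + t)) ≃ₐ[K] (κ.layer (n + t))) :=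
      { toFun := fun σ => σ.restrictScalars K
        map_one' := rfl
        map_mul' := fun _ _ => rfl }
    have hj : Function.Injective j := fun σ τ h => AlgEquiv.restrictScalars_injective K h
    exact isCyclic_of_surjective (MonoidHom.ofInjective hj).symm.toMonoidHom (MonoidHom.ofInjective hj).symm.surjective
  -- ### the Hilbert class field `H_T`, Galois over `Bi`
  haveI : IsGalois Bi (hilbertClassField (κ.layer (n + t))) := hilbertClassField.isGalois_of_isGalois (κ.layer (n + t))
  haveI : FiniteDimensional Bi (hilbertClassField (κ.layer (n + t))) := Module.Finite.trans (κ.layer (n + t)) (hilbertClassField (κ.layer (n + t)))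
  haveI : IsUnramifiedAtInfinitePlaces K (κ.layer (n + t)) := κ.isUnramifiedAtInfinitePlaces_layer (n + t)
  haveI : IsUnramifiedAtInfinitePlaces Bi (κ.layer (n + t)) :=
    IsUnramifiedAtInfinitePlaces.top (k := K) (K := Bi) (F := (κ.layer (n + t)))
  haveI : IsUnramifiedAtInfinitePlaces Bi (hilbertClassField (κ.layer (n + t))) := IsUnramifiedAtInfinitePlaces.trans Bi (κ.layer (n + t)) (hilbertClassField (κ.layer (n + t)))
  -- `A = Gal(H_T/T) = ker (Gal(H_T/B) → Gal(T/B))`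
  obtain ⟨πF, hπF⟩ : ∃ πF : ((hilbertClassField (κ.layer (n + t))) ≃ₐ[Bi] (hilbertClassField (κ.layer (n + t)))) →* ((κ.layer (n + t)) ≃ₐ[Bi] (κ.layer (n + t))), πF = AlgEquiv.restrictNormalHom (κ.layer (n + t)) :=
    ⟨_, rfl⟩
  have hπF_surj : Function.Surjective πF := by
    rw [hπF]; exact AlgEquiv.restrictNormalHom_surjective (hilbertClassField (κ.layer (n + t)))
  have hπF_apply : ∀ g : (hilbertClassField (κ.layer (n + t))) ≃ₐ[Bi] (hilbertClassField (κ.layer (n + t))), πF g = g.restrictNormal (κ.layer (n + t)) := fun g => by rw [hπF]; rfl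
  obtain ⟨A, hA⟩ : ∃ A : Subgroup ((hilbertClassField (κ.layer (n + t))) ≃ₐ[Bi] (hilbertClassField (κ.layer (n + t)))), A = πF.ker := ⟨_, rfl⟩
  haveI hAn : A.Normal := by rw [hA]; infer_instance
  have hmemA : ∀ g : (hilbertClassField (κ.layer (n + t))) ≃ₐ[Bi] (hilbertClassField (κ.layer (n + t))), g ∈ A ↔ ∀ x : (κ.layer (n + t)), g (algebraMap (κ.layer (n + t)) (hilbertClassField (κ.layer (n + t))) x) = algebraMap (κ.layer (n + t)) (hilbertClassField (κ.layer (n + t))) x := by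
    intro g
    rw [hA, MonoidHom.mem_ker]
    constructor
    · intro h x
      have h1 := AlgEquiv.restrictNormal_commutes g (κ.layer (n + t)) x
      rw [← hπF_apply, h, AlgEquiv.one_apply] at h1
      exact h1.symm
    · intro h
      apply AlgEquiv.ext
      intro x
      apply (algebraMap (κ.layer (n + t)) (hilbertClassField (κ.layer (n + t)))).injective
      rw [AlgEquiv.one_apply, hπF_apply, AlgEquiv.restrictNormal_commutes]
      exact h x
  have toF : ∀ g ∈ A, ∃ g' : (hilbertClassField (κ.layer (n + t))) ≃ₐ[(κ.layer (n + t))] (hilbertClassField (κ.layer (n + t))), ∀ x, g' x = g x := fun g hg =>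
    ⟨{ g with commutes' := fun x => (hmemA g).mp hg x }, fun _ => rfl⟩
  have hAcomm : ∀ a ∈ A, ∀ b ∈ A, a * b = b * a := by
    intro a ha b hb
    obtain ⟨a', ha'⟩ := toF a ha
    obtain ⟨b', hb'⟩ := toF b hb
    have hc : a' * b' = b' * a' := (IsAbelianGalois.toIsMulCommutative (K := ↥(κ.layer (n + t))) (L := (hilbertClassField (κ.layer (n + t))))).is_comm.comm a' b'
    apply AlgEquiv.ext
    intro x
    have h := congrArg (fun f : (hilbertClassField (κ.layer (n + t))) ≃ₐ[(κ.layer (n + t))] (hilbertClassField (κ.layer (n + t))) => f x) hc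
    simp only [AlgEquiv.mul_apply] at h ⊢
    rw [← ha', ← hb', h, hb', ha']
  haveI : IsMulCommutative A := ⟨⟨fun a b => Subtype.ext (hAcomm a a.2 b b.2)⟩⟩
  have hAindex : A.index = p ^ t := by
    rw [hA, Subgroup.index_ker, MonoidHom.range_eq_top.mpr hπF_surj, Subgroup.card_top, IsGalois.card_aut_eq_finrank, hdegBF]
  have hAcard : Nat.card A = classNumber (κ.layer (n + t)) := by
    have h1 : A.index * Nat.card A = Nat.card ((hilbertClassField (κ.layer (n + t))) ≃ₐ[Bi] (hilbertClassField (κ.layer (n + t)))) := A.index_mul_card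
    rw [hAindex, IsGalois.card_aut_eq_finrank, ← Module.finrank_mul_finrank Bi (κ.layer (n + t)) (hilbertClassField (κ.layer (n + t))), hdegBF,
      hilbertClassField.finrank_eq_classNumber] at h1
    exact Nat.eq_of_mul_eq_mul_left (pow_pos hp0 t) h1
  -- ### the prime-to-`p` part `A₀` of `A` and the `p`-Hilbert class field `Hp = H_T^{A₀}`
  obtain ⟨A₀', hA₀'mem, hA₀'index⟩ := exists_subgroup_index_eq_pow_padicValNat_card A p
  obtain ⟨A₀, hA₀⟩ : ∃ A₀ : Subgroup ((hilbertClassField (κ.layer (n + t))) ≃ₐ[Bi] (hilbertClassField (κ.layer (n + t)))), A₀ = A₀'.map A.subtype := ⟨_, rfl⟩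
  have hA₀A : A₀ ≤ A := by
    rw [hA₀]; rintro _ ⟨g, -, rfl⟩; exact g.2
  have hmemA₀ : ∀ g, g ∈ A₀ ↔ g ∈ A ∧ ¬ p ∣ orderOf g := by
    intro g
    rw [hA₀, Subgroup.mem_map]
    constructor
    · rintro ⟨g', hg', rfl⟩
      refine ⟨g'.2, ?_⟩
      rw [Subgroup.coe_subtype, Subgroup.orderOf_coe]
      exact (hA₀'mem g').mp hg'
    · rintro ⟨hgA, hg⟩
      refine ⟨⟨g, hgA⟩, (hA₀'mem _).mpr ?_, rfl⟩
      rwa [Subgroup.orderOf_mk]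
  haveI hA₀n : A₀.Normal := ⟨fun m hm g => by
    rw [hmemA₀] at hm ⊢
    refine ⟨hAn.conj_mem m hm.1 g, ?_⟩
    have : orderOf (g * m * g⁻¹) = orderOf m := by
      rw [show g * m * g⁻¹ = MulAut.conj g m from rfl]
      exact orderOf_injective (MulAut.conj g).toMonoidHom (MulAut.conj g).injective m
    rw [this]; exact hm.2⟩
  have hA₀relindex : A₀.relIndex A = p ^ padicValNat p (classNumber (κ.layer (n + t))) := by
    rw [← hAcard, ← hA₀'index, Subgroup.relIndex, hA₀]
    congr 1
    ext g
    simp only [Subgroup.mem_subgroupOf, Subgroup.mem_map, Subgroup.coe_subtype]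
    constructor
    · rintro ⟨g', hg', hgg'⟩
      have : g' = g := Subtype.ext hgg'
      rwa [← this]
    · intro hg; exact ⟨g, hg, rfl⟩
  obtain ⟨Hp, hHp⟩ : ∃ Hp : IntermediateField Bi (hilbertClassField (κ.layer (n + t))), Hp = IntermediateField.fixedField A₀ := ⟨_, rfl⟩
  haveI hHpGal : IsGalois Bi Hp := by rw [hHp]; exact IsGalois.of_fixedField_normal_subgroup A₀
  have hFmem : ∀ x : (κ.layer (n + t)), algebraMap (κ.layer (n + t)) (hilbertClassField (κ.layer (n + t))) x ∈ Hp := by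
    intro x
    rw [hHp, IntermediateField.mem_fixedField_iff]
    intro g hg
    exact (hmemA g).mp (hA₀A hg) x
  -- `Hp` as an intermediate field OVER `T` (same carrier): `HqF`
  obtain ⟨HqF, hmemHqF⟩ : ∃ HqF : IntermediateField (κ.layer (n + t)) (hilbertClassField (κ.layer (n + t))), ∀ x : (hilbertClassField (κ.layer (n + t))), x ∈ HqF ↔ x ∈ Hp :=
    ⟨Hp.toSubfield.toIntermediateField hFmem, fun _ => Iff.rfl⟩
  let eHq : Hp ≃ₐ[Bi] HqF :=
    { toFun := fun x => ⟨(x : (hilbertClassField (κ.layer (n + t)))), (hmemHqF _).mpr x.2⟩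
      invFun := fun x => ⟨(x : (hilbertClassField (κ.layer (n + t)))), (hmemHqF _).mp x.2⟩
      left_inv := fun _ => rfl
      right_inv := fun _ => rfl
      map_mul' := fun _ _ => rfl
      map_add' := fun _ _ => rfl
      commutes' := fun _ => rfl }
  haveI : IsGalois Bi HqF := IsGalois.of_algEquiv eHq
  haveI : FiniteDimensional Bi HqF := LinearEquiv.finiteDimensional eHq.toLinearEquiv
  haveI : NumberField HqF := NumberField.of_module_finite (κ.layer (n + t)) HqF
  haveI : IsScalarTower Bi HqF (hilbertClassField (κ.layer (n + t))) := IsScalarTower.of_algebraMap_eq fun _ => rfl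
  haveI : IsGalois (κ.layer (n + t)) HqF := IsGalois.tower_top_of_isGalois Bi (κ.layer (n + t)) HqF
  haveI : IsUnramifiedAtInfinitePlaces Bi HqF := IsUnramifiedAtInfinitePlaces.bot (k := Bi) (K := HqF) (F := (hilbertClassField (κ.layer (n + t))))
  -- ### `Gal(H_T/T) ↪ Gal(H_T/B)` with image `A`; every `p`-power sub-extension of `H_T/T` lies in `HqF`
  let ρE : ((hilbertClassField (κ.layer (n + t))) ≃ₐ[(κ.layer (n + t))] (hilbertClassField (κ.layer (n + t)))) →* ((hilbertClassField (κ.layer (n + t))) ≃ₐ[Bi] (hilbertClassField (κ.layer (n + t)))) :=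
    { toFun := fun σ => σ.restrictScalars Bi
      map_one' := rfl
      map_mul' := fun _ _ => rfl }
  have hρE_inj : Function.Injective ρE := fun σ τ h => AlgEquiv.restrictScalars_injective Bi h
  have hρE_surj : ∀ g ∈ A, ∃ σ, ρE σ = g := fun g hg =>
    ⟨{ g with commutes' := fun x => (hmemA g).mp hg x }, AlgEquiv.ext fun _ => rfl⟩
  have hmax : ∀ L : IntermediateField (κ.layer (n + t)) (hilbertClassField (κ.layer (n + t))), (∃ k, Module.finrank (κ.layer (n + t)) L = p ^ k) → L ≤ HqF := by
    rintro L ⟨k, hk⟩ x hx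
    rw [hmemHqF, hHp, IntermediateField.mem_fixedField_iff]
    intro g hg
    obtain ⟨σ, rfl⟩ := hρE_surj g (hA₀A hg)
    have hσord : ¬ p ∣ orderOf σ := by
      have h1 := ((hmemA₀ _).mp hg).2
      rwa [orderOf_injective ρE hρE_inj σ] at h1
    set τ := AlgEquiv.restrictNormalHom L σ with hτ
    have hτ1 : τ = 1 := by
      have h1 : orderOf τ ∣ p ^ k := by
        rw [← hk, ← IsGalois.card_aut_eq_finrank]
        exact orderOf_dvd_natCard τ
      obtain ⟨j, -, hj⟩ := (Nat.dvd_prime_pow hp.out).mp h1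
      have h2 : orderOf τ ∣ orderOf σ := orderOf_map_dvd _ σ
      rcases j with _ | j
      · rwa [pow_zero, orderOf_eq_one_iff] at hj
      · exact absurd ((Dvd.intro_left _ (pow_succ p j).symm).trans (hj ▸ h2)) hσord
    have h3 := AlgEquiv.restrictNormal_commutes σ L ⟨x, hx⟩
    rw [show σ.restrictNormal L = τ from rfl, hτ1, AlgEquiv.one_apply] at h3
    exact h3.symm
  -- ### the Galois group `Gp = Gal(H_p/B)` (`H_p = HqF`), `A' = Gal(H_p/T)`
  haveI : IsScalarTower Bi (κ.layer (n + t)) HqF := IsScalarTower.of_algebraMap_eq fun _ => rfl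
  obtain ⟨res, hresdef⟩ : ∃ res : (HqF ≃ₐ[Bi] HqF) →* ((κ.layer (n + t)) ≃ₐ[Bi] (κ.layer (n + t))), res = AlgEquiv.restrictNormalHom (κ.layer (n + t)) :=
    ⟨_, rfl⟩
  have hres_surj : Function.Surjective res := by
    rw [hresdef]; exact AlgEquiv.restrictNormalHom_surjective HqF
  have hres_apply : ∀ g : HqF ≃ₐ[Bi] HqF, res g = g.restrictNormal (κ.layer (n + t)) := fun g => by rw [hresdef]; rfl
  obtain ⟨A', hA'⟩ : ∃ A' : Subgroup (HqF ≃ₐ[Bi] HqF), A' = res.ker := ⟨_, rfl⟩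
  haveI hA'n : A'.Normal := by rw [hA']; infer_instance
  have hA'index : A'.index = p ^ t := by
    rw [hA', Subgroup.index_ker, MonoidHom.range_eq_top.mpr hres_surj, Subgroup.card_top, IsGalois.card_aut_eq_finrank, hdegBF]
  have hcycQ : IsCyclic ((HqF ≃ₐ[Bi] HqF) ⧸ A') :=
    isCyclic_of_surjective _ (((QuotientGroup.quotientKerEquivOfSurjective res hres_surj).symm.trans
      (QuotientGroup.quotientMulEquivOfEq hA').symm).surjective)
  have hmemA' : ∀ g : HqF ≃ₐ[Bi] HqF, g ∈ A' ↔ ∀ x : (κ.layer (n + t)), g (algebraMap (κ.layer (n + t)) HqF x) = algebraMap (κ.layer (n + t)) HqF x := by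
    intro g
    rw [hA', MonoidHom.mem_ker]
    constructor
    · intro h x
      have h1 := AlgEquiv.restrictNormal_commutes g (κ.layer (n + t)) x
      rw [← hres_apply, h, AlgEquiv.one_apply] at h1
      exact h1.symm
    · intro h
      apply AlgEquiv.ext
      intro x
      apply (algebraMap (κ.layer (n + t)) HqF).injective
      rw [AlgEquiv.one_apply, hres_apply, AlgEquiv.restrictNormal_commutes]
      exact h x
  let ρT : (HqF ≃ₐ[(κ.layer (n + t))] HqF) →* (HqF ≃ₐ[Bi] HqF) :=
    { toFun := fun σ => σ.restrictScalars Bi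
      map_one' := rfl
      map_mul' := fun _ _ => rfl }
  have hρT_inj : Function.Injective ρT := fun σ τ h => AlgEquiv.restrictScalars_injective Bi h
  have hρT_range : ρT.range = A' := by
    ext g
    constructor
    · rintro ⟨σ, rfl⟩
      exact (hmemA' _).mpr fun x => σ.commutes x
    · intro hg
      exact ⟨{ g with commutes' := fun x => (hmemA' g).mp hg x }, AlgEquiv.ext fun _ => rfl⟩
  have hA'comm : ∀ a ∈ A', ∀ b ∈ A', a * b = b * a := by
    intro a ha b hb
    rw [← hρT_range] at ha hb
    obtain ⟨σ, rfl⟩ := ha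
    obtain ⟨τ, rfl⟩ := hb
    rw [← map_mul, ← map_mul, (IsAbelianGalois.toIsMulCommutative (K := ↥(κ.layer (n + t))) (L := ↥HqF)).is_comm.comm σ τ]
  haveI : IsMulCommutative A' := ⟨⟨fun a b => Subtype.ext (hA'comm a a.2 b b.2)⟩⟩
  -- `#Gp = p^t · p^{e_{n+t}}`, `#A' = p^{e_{n+t}}`
  have hA₀card : p ^ padicValNat p (classNumber (κ.layer (n + t))) * Nat.card A₀ = classNumber (κ.layer (n + t)) := by
    rw [← hA₀relindex, ← hAcard, Subgroup.relIndex,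
      ← Nat.card_congr (Subgroup.subgroupOfEquivOfLe hA₀A).toEquiv]
    exact Subgroup.index_mul_card _
  have hA₀pos : 0 < Nat.card A₀ := Nat.card_pos
  haveI : Module.Free Bi Hp := Module.Free.of_divisionRing Bi Hp
  haveI : Module.Free Hp (hilbertClassField (κ.layer (n + t))) := Module.Free.of_divisionRing Hp _
  haveI : Module.Free Bi (hilbertClassField (κ.layer (n + t))) := Module.Free.of_divisionRing Bi _
  haveI : Module.Free (κ.layer (n + t)) (hilbertClassField (κ.layer (n + t))) := Module.Free.of_divisionRing _ _
  haveI : Module.Free Bi (κ.layer (n + t)) := Module.Free.of_divisionRing Bi _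
  have hdegHp : Module.finrank Bi HqF = p ^ t * p ^ padicValNat p (classNumber (κ.layer (n + t))) := by
    rw [← eHq.toLinearEquiv.finrank_eq]
    have h1 := Module.finrank_mul_finrank Bi Hp (hilbertClassField (κ.layer (n + t)))
    rw [hHp, IntermediateField.finrank_fixedField_eq_card A₀, ← hHp,
      ← Module.finrank_mul_finrank Bi (κ.layer (n + t)) (hilbertClassField (κ.layer (n + t))), hdegBF, hilbertClassField.finrank_eq_classNumber,
      ← hA₀card, ← mul_assoc] at h1
    exact Nat.eq_of_mul_eq_mul_right hA₀pos h1
  have hGpcard : Nat.card (HqF ≃ₐ[Bi] HqF) = p ^ t * p ^ padicValNat p (classNumber (κ.layer (n + t))) := by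
    rw [IsGalois.card_aut_eq_finrank, hdegHp]
  have hA'card : Nat.card A' = p ^ padicValNat p (classNumber (κ.layer (n + t))) := by
    have h1 := A'.index_mul_card
    rw [hA'index, hGpcard] at h1
    exact Nat.eq_of_mul_eq_mul_left (pow_pos hp0 t) h1
  have hApg : IsPGroup p A' := IsPGroup.of_card hA'card
  -- ### inertia groups: `I(𝔔) ≤ Gp` meets `A'` trivially and is trivial or a complement of `A'`
  have heT : ∀ (Q : Ideal (𝓞 HqF)) [Q.IsMaximal], Q.ramificationIdx (𝓞 (κ.layer (n + t))) = 1 := by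
    intro Q _
    obtain ⟨P, hPmax, hPQ⟩ := Ideal.exists_maximal_ideal_liesOver_of_isIntegral (S := 𝓞 (hilbertClassField (κ.layer (n + t)))) Q
    haveI := hPmax
    haveI := hPQ
    haveI := hilbertClassField.isUnramifiedAt (κ.layer (n + t)) P
    have h1 : P.ramificationIdx (𝓞 (κ.layer (n + t))) = 1 := Ideal.ramificationIdx_eq_one P (𝓞 (κ.layer (n + t)))
    rw [Ideal.ramificationIdx_tower Q P] at h1
    exact Nat.eq_one_of_mul_eq_one_right h1
  have hcardI : ∀ (Q : Ideal (𝓞 HqF)) [Q.IsMaximal],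
      Nat.card (Q.inertia (HqF ≃ₐ[Bi] HqF)) = Nat.card ((Q.under (𝓞 (κ.layer (n + t)))).inertia ((κ.layer (n + t)) ≃ₐ[Bi] (κ.layer (n + t)))) := by
    intro Q _
    haveI : (Q.under (𝓞 (κ.layer (n + t)))).IsMaximal := Ideal.IsMaximal.under (𝓞 (κ.layer (n + t))) Q
    rw [card_inertia_eq_ramificationIdx HqF (HqF ≃ₐ[Bi] HqF) Bi Q,
      card_inertia_eq_ramificationIdx (κ.layer (n + t)) ((κ.layer (n + t)) ≃ₐ[Bi] (κ.layer (n + t))) Bi (Q.under (𝓞 (κ.layer (n + t)))),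
      Ideal.ramificationIdx_tower (Q.under (𝓞 (κ.layer (n + t)))) Q, heT Q, mul_one]
  have htop_of : ∀ (q : Ideal (𝓞 (κ.layer (n + t)))) [q.IsMaximal],
      (∀ g : (κ.layer (n + t)) ≃ₐ[K] (κ.layer (n + t)), (∀ x : (κ.layer (n + t)), (x : AlgebraicClosure K) ∈ κ.layer n → g x = x) →
        g ∈ q.inertia ((κ.layer (n + t)) ≃ₐ[K] (κ.layer (n + t)))) → q.inertia ((κ.layer (n + t)) ≃ₐ[Bi] (κ.layer (n + t))) = ⊤ := by
    intro q _ h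
    rw [eq_top_iff]
    intro σ _
    have h1 : σ.restrictScalars K ∈ q.inertia ((κ.layer (n + t)) ≃ₐ[K] (κ.layer (n + t))) := by
      apply h
      intro x hx
      have hxB : x ∈ Bi := by rw [hBi, IntermediateField.mem_restrict]; exact hx
      exact σ.commutes ⟨x, hxB⟩
    exact fun y => h1 y
  have hdich : ∀ (q : Ideal (𝓞 (κ.layer (n + t)))) [q.IsMaximal],
      q.inertia ((κ.layer (n + t)) ≃ₐ[Bi] (κ.layer (n + t))) = ⊥ ∨ q.inertia ((κ.layer (n + t)) ≃ₐ[Bi] (κ.layer (n + t))) = ⊤ := by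
    intro q _
    rcases κ.inertia_layer_eq_bot_or_forall_mem hκ hn (Nat.le_add_right n t) q with h1 | h2
    · left
      rw [eq_bot_iff]
      intro σ hσ
      have h3 : σ.restrictScalars K ∈ q.inertia ((κ.layer (n + t)) ≃ₐ[K] (κ.layer (n + t))) := fun y => hσ y
      rw [h1, Subgroup.mem_bot] at h3
      rw [Subgroup.mem_bot]
      apply AlgEquiv.restrictScalars_injective K
      rw [h3]
      rfl
    · exact Or.inr (htop_of q h2)
  have hinf : ∀ (Q : Ideal (𝓞 HqF)) [Q.IsMaximal], Q.inertia (HqF ≃ₐ[Bi] HqF) ⊓ A' = ⊥ := by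
    intro Q _
    have h1 : (Q.inertia (HqF ≃ₐ[(κ.layer (n + t))] HqF)).map ρT = Q.inertia (HqF ≃ₐ[Bi] HqF) ⊓ A' := by
      ext g
      constructor
      · rintro ⟨σ, hσ, rfl⟩
        exact ⟨fun y => hσ y, hρT_range ▸ ⟨σ, rfl⟩⟩
      · rintro ⟨hgI, hgA⟩
        rw [← hρT_range] at hgA
        obtain ⟨σ, rfl⟩ := hgA
        exact ⟨σ, fun y => hgI y, rfl⟩
    rw [← h1, ← Subgroup.card_eq_one, Subgroup.card_map_of_injective hρT_inj,
      card_inertia_eq_ramificationIdx HqF (HqF ≃ₐ[(κ.layer (n + t))] HqF) (κ.layer (n + t)) Q, heT Q]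
  have hsup : ∀ (Q : Ideal (𝓞 HqF)) [Q.IsMaximal], Nat.card (Q.inertia (HqF ≃ₐ[Bi] HqF)) = p ^ t →
      Q.inertia (HqF ≃ₐ[Bi] HqF) ⊔ A' = ⊤ := by
    intro Q _ hc
    have h1 : A'.relIndex (Q.inertia (HqF ≃ₐ[Bi] HqF) ⊔ A') = p ^ t := by
      rw [Subgroup.relIndex_sup_right, Subgroup.relIndex,
        Subgroup.subgroupOf_eq_bot.mpr (disjoint_iff.mpr ((inf_comm _ _).trans (hinf Q))), Subgroup.index_bot, hc]
    have h2 := Subgroup.relIndex_mul_index (le_sup_right : A' ≤ Q.inertia (HqF ≃ₐ[Bi] HqF) ⊔ A')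
    rw [h1, hA'index] at h2
    exact Subgroup.index_eq_one.mp (Nat.eq_of_mul_eq_mul_left (pow_pos hp0 t) (h2.trans (mul_one _).symm))
  have hcases : ∀ (Q : Ideal (𝓞 HqF)) [Q.IsMaximal],
      Q.inertia (HqF ≃ₐ[Bi] HqF) = ⊥ ∨ Q.inertia (HqF ≃ₐ[Bi] HqF) ⊔ A' = ⊤ := by
    intro Q _
    haveI : (Q.under (𝓞 (κ.layer (n + t)))).IsMaximal := Ideal.IsMaximal.under (𝓞 (κ.layer (n + t))) Q
    rcases hdich (Q.under (𝓞 (κ.layer (n + t)))) with h1 | h2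
    · left
      rw [← Subgroup.card_eq_one, hcardI Q, h1, Subgroup.card_bot]
    · right
      apply hsup Q
      rw [hcardI Q, h2, Subgroup.card_top, IsGalois.card_aut_eq_finrank, hdegBF]
  have hexists : ∃ (Q : Ideal (𝓞 HqF)) (_ : Q.IsMaximal), Q.inertia (HqF ≃ₐ[Bi] HqF) ⊔ A' = ⊤ := by
    obtain ⟨q, hqmax, hq⟩ := κ.exists_isMaximal_forall_mem_inertia hκ hn (Nat.le_add_right n t) (by omega)
    haveI := hqmax
    obtain ⟨Q, hQmax, hQq⟩ := Ideal.exists_maximal_ideal_liesOver_of_isIntegral (S := 𝓞 HqF) q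
    haveI := hQmax
    refine ⟨Q, hQmax, hsup Q ?_⟩
    rw [hcardI Q, ← hQq.over, htop_of q hq, Subgroup.card_top, IsGalois.card_aut_eq_finrank, hdegBF]
  -- ### the family `𝓘` of inertia groups, and a generator `g` of a totally ramified one
  obtain ⟨𝓘, h𝓘def⟩ : ∃ 𝓘 : Set (Subgroup (HqF ≃ₐ[Bi] HqF)),
      𝓘 = Set.range (fun Q : MaximalSpectrum (𝓞 HqF) => Q.asIdeal.inertia (HqF ≃ₐ[Bi] HqF)) := ⟨_, rfl⟩
  have h𝓘 : ∀ I ∈ 𝓘, I ⊓ A' = ⊥ ∧ (I = ⊥ ∨ I ⊔ A' = ⊤) := by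
    intro I hI
    rw [h𝓘def] at hI
    obtain ⟨Q, rfl⟩ := hI
    haveI := Q.isMaximal
    exact ⟨hinf Q.asIdeal, hcases Q.asIdeal⟩
  obtain ⟨g, hgA, hgen, hg𝓘⟩ : ∃ g : HqF ≃ₐ[Bi] HqF, Subgroup.zpowers g ⊓ A' = ⊥ ∧ A' ⊔ Subgroup.zpowers g = ⊤ ∧ Subgroup.zpowers g ∈ 𝓘 := by
    obtain ⟨Q, hQ, hQsup⟩ := hexists
    haveI := hQ
    have hQinf := hinf Q
    set I₁ := Q.inertia (HqF ≃ₐ[Bi] HqF) with hI₁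
    -- `I₁` embeds into the cyclic group `Gp/A'`, hence is cyclic
    let f : I₁ →* (HqF ≃ₐ[Bi] HqF) ⧸ A' := (QuotientGroup.mk' A').comp I₁.subtype
    have hf : Function.Injective f := by
      intro x y hxy
      have h1 : ((x : HqF ≃ₐ[Bi] HqF))⁻¹ * y ∈ A' := by
        rw [← QuotientGroup.eq]; exact hxy
      have h2 : ((x : HqF ≃ₐ[Bi] HqF))⁻¹ * y ∈ I₁ ⊓ A' := ⟨I₁.mul_mem (I₁.inv_mem x.2) y.2, h1⟩
      rw [hQinf, Subgroup.mem_bot, inv_mul_eq_one] at h2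
      exact Subtype.ext h2
    haveI : IsCyclic I₁ :=
      isCyclic_of_surjective (MonoidHom.ofInjective hf).symm.toMonoidHom (MonoidHom.ofInjective hf).symm.surjective
    obtain ⟨g₀, hg₀⟩ := IsCyclic.exists_generator (α := I₁)
    have hzp : Subgroup.zpowers (g₀ : HqF ≃ₐ[Bi] HqF) = I₁ := by
      apply le_antisymm
      · exact (Subgroup.zpowers_le).mpr g₀.2
      · intro x hx
        obtain ⟨k, hk⟩ := Subgroup.mem_zpowers_iff.mp (hg₀ ⟨x, hx⟩)
        exact Subgroup.mem_zpowers_iff.mpr ⟨k, by rw [← Subgroup.coe_zpow, hk]⟩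
    refine ⟨g₀, by rw [hzp]; exact hQinf, by rw [hzp, sup_comm]; exact hQsup, ?_⟩
    rw [hzp, h𝓘def]
    exact ⟨⟨Q, hQ⟩, rfl⟩
  -- ### the layers (`Fukuda1994Thm1RankLayer.exists_layer`) and the package
  have hlayer : ∀ j, j ≤ t → ∃ Gj : Subgroup (HqF ≃ₐ[Bi] HqF), A' ≤ Gj ∧ Gj.index = p ^ j ∧
      (⁅Gj, Gj⁆ ⊔ ⨆ I ∈ 𝓘, I ⊓ Gj).relIndex Gj = p ^ classNumberPExp κ (n + j) ∧
      ((⁅Gj, Gj⁆ ⊔ ⨆ I ∈ 𝓘, I ⊓ Gj) ⊔ Subgroup.closure ((fun x : HqF ≃ₐ[Bi] HqF => x ^ p) '' (Gj : Set (HqF ≃ₐ[Bi] HqF)))).relIndex Gj =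
        p ^ classGroupPRank κ (n + j) ∧
      ∀ i, i ≤ j →
        (((⁅Gj, Gj⁆ ⊔ ⨆ I ∈ 𝓘, I ⊓ Gj) ⊔ Subgroup.closure ((fun x : HqF ≃ₐ[Bi] HqF => x ^ p) '' (Gj : Set (HqF ≃ₐ[Bi] HqF)))) ⊔
            ⁅A' ⊔ Subgroup.zpowers (g ^ p ^ i), Gj⁆).relIndex Gj ∣
          ((powMonoidHom p : ClassGroup (𝓞 (κ.layer (n + j))) →* ClassGroup (𝓞 (κ.layer (n + j)))).range ⊔
            Subgroup.closure {x | ∃ (σ : (κ.layer (n + j)) ≃ₐ[K] (κ.layer (n + j)))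
              (_ : ∀ y : κ.layer (n + j), ((y : κ.layer (n + j)) : AlgebraicClosure K) ∈ κ.layer (n + i) → σ y = y)
              (c : ClassGroup (𝓞 (κ.layer (n + j)))), x = ClassGroup.mulEquiv (AmbiguousClass.intAut σ) c * c⁻¹}).index := by
    intro j hj
    obtain ⟨Gj, hAGj, hGj, he, hr⟩ := exists_layer κ n t j hj Bi hBi hdegKB HqF hmax _ hdegHp A' hmemA' 𝓘 h𝓘def
    refine ⟨Gj, hAGj, hGj, he, hr, fun i hij => ?_⟩
    -- the coinvariant layers (`exists_layer_coinvariant`) are the same subgroups: `G_j = A'·⟨g^{p^j}⟩`, `G_i = A'·⟨g^{p^i}⟩`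
    -- (`FukudaGroup.layer_eq_sup_zpowers`)
    obtain ⟨Gi', Gj', hAGj', hGjGi', hGi', hGj', hdvd⟩ :=
      exists_layer_coinvariant κ n t i j hij hj Bi hBi hdegKB HqF _ hdegHp A' hmemA' 𝓘 h𝓘def
    have h1 := FukudaGroup.layer_eq_sup_zpowers hgA hgen hA'index hj hAGj hGj
    have h2 := FukudaGroup.layer_eq_sup_zpowers hgA hgen hA'index hj hAGj' hGj'
    have h3 := FukudaGroup.layer_eq_sup_zpowers hgA hgen hA'index (hij.trans hj) (hAGj'.trans hGjGi') hGi'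
    rw [h1.trans h2.symm, ← h3]
    exact hdvd
  refine ⟨HqF ≃ₐ[Bi] HqF, inferInstance, inferInstance, A', hA'n, inferInstance, g, 𝓘, hgA, hgen, hA'index, h𝓘, hg𝓘, ?_, hlayer⟩
  rw [hA'card, classNumberPExp_eq_padicValNat_classNumber]

end Literature.NumberTheory.IwasawaTheory

end
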